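import Literature.Probability.LatticeModels.HighDimPointwiseTriviality
import Literature.Probability.LatticeModels.CorrelationInequalitiesProofs
import Literature.Probability.LatticeModels.SourcedDoubleCurrentsSwitching
import HarnessLib

/-!
# The critical Ursell four-point function on `ℤ^d`: sign, the `2⟨σσ⟩⟨σσ⟩` bound, odd correlators,
# and the sign of `U₄` of every pointwise scaling limit

Topic `Probability/LatticeModels`; family `crit-ising`. THEOREM-ONLY leaf file (no definitions, no
named facts): infinite-volume, critical-state (`criticalCorr d`, `d ≥ 3`) forms of three classical
finite-volume facts of the tree, obtained by the box limit `criticalCorr_wellDefined_holds`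
(free boundary condition, `Λ_L ↑ ℤ^d`), and one consequence for pointwise scaling limits:

* `criticalCorr_eq_zero_of_odd` — odd critical correlators vanish (`m*(β_c) = 0`,
  Aizenman–Duminil-Copin–Sidoravicius 2015, tree theorem
  `spontaneousMagnetization_criticalBeta_eq_zero_holds`, with `plusCorr_eq_zero_of_odd_card`).
* `criticalUrsellFour_nonpos` — Lebowitz' inequality `U₄ ≤ 0` for the critical state (box limit of
  `lebowitz_holds`; Lebowitz 1974, Glimm–Jaffe Cor. 4.3.3).
* `abs_criticalUrsellFour_le_two_mul` — `|U₄(y)| ≤ 2⟨σ_{y₀}σ_{y₁}⟩⟨σ_{y₂}σ_{y₃}⟩` (box limit of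
  the PROVED random-current identity `connectedFour_free_box_eq`, Aizenman–Duminil-Copin 2021 (3.11),
  and `P ≤ 1`; the total-mass bound `doubleCurrentMeasure_real_le_one` covers the junk zero measure).
* `limitConnectedFour_nonpos_of_hasPointwiseScalingLimit` — for every pointwise scaling limit `S` of
  the critical correlators (any renormalisation `ρ`, any `d ≥ 3`), `U₄^S ≤ 0` on non-coincident
  configurations; so `HasNontrivialU4 S ↔ ∃ x ∈ NonCoincident d 4, U₄^S x < 0`
  (`hasNontrivialU4_iff_exists_neg_of_hasPointwiseScalingLimit`): clause (iii) of the conformal-limit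
  problem on `ℤ³` is a one-sided statement.

`U₄(y)` is written out as `criticalCorr d 4 y - (∑ pairings)`, exactly as in
`abs_criticalU4_le` of `HighDimPointwiseTriviality` (no auxiliary definition).

## References

* J. L. Lebowitz, Comm. Math. Phys. 35 (1974) 87–92, Theorem, (2.5b) [Lebowitz1974].
* J. Glimm, A. Jaffe, *Quantum Physics*, 2nd ed. (Springer 1987), Cor. 4.3.3 [GlimmJaffe1987].
* M. Aizenman, H. Duminil-Copin, Ann. Math. 194 (2021), §3.2 eqs. (3.11)–(3.12)
  [AizenmanDuminilCopinAnnals2021].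
* M. Aizenman, H. Duminil-Copin, V. Sidoravicius, Comm. Math. Phys. 334 (2015), Thm. 1.2
  [AizenmanDuminilCopinSidoraviciusCMP2015].
* H. Duminil-Copin, *Random currents expansion of the Ising model* (2016), §2.2 [DuminilCopin2016].
-/

noncomputable section

namespace Literature.Probability.LatticeModels

open Literature.Probability.Percolation _root_.MeasureTheory Filter Finset
open scoped _root_.Topology symmDiff

variable {d : ℕ}

/-! ### Odd critical correlators vanish -/

/-- Spin monomials with an odd number of factors are odd spin products: `∏ᵢ σ_{yᵢ} = σ_A` with `|A|`
odd (`σ² = 1`; parity read off at the all-minus configuration). [cite: FriedliVelenik2017, §3.6.1] -/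
theorem exists_spinMonomial_eq_spinProduct_odd {n : ℕ} (hn : Odd n) (y : Fin n → Site d) :
    ∃ A : Finset (Site d), Odd A.card ∧ spinMonomial y = spinProduct A := by
  classical
  obtain ⟨A, hA⟩ := exists_spinMonomial_eq_spinProduct y
  refine ⟨A, ?_, hA⟩
  have h := congrFun hA (fun _ => -1)
  simp only [spinMonomial, spinProduct, spinAt] at h
  have hl : (∏ _i : Fin n, ((((-1 : ℤˣ)) : ℤ) : ℝ)) = (-1) ^ n := by simp
  have hr : (∏ _v ∈ A, ((((-1 : ℤˣ)) : ℤ) : ℝ)) = (-1) ^ A.card := by simp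
  rw [hl, hr, hn.neg_one_pow] at h
  by_contra hev
  rw [Nat.not_odd_iff_even] at hev
  rw [hev.neg_one_pow] at h
  norm_num at h

/-- **Odd critical correlators vanish** (`d ≥ 3`): `⟨∏ᵢ σ_{yᵢ}⟩_{β_c} = 0` for odd `n`, by
`m*(β_c) = 0` (Aizenman–Duminil-Copin–Sidoravicius 2015; tree theorem
`spontaneousMagnetization_criticalBeta_eq_zero_holds`) and `plusCorr_eq_zero_of_odd_card`.
[cite: AizenmanDuminilCopinSidoraviciusCMP2015, Thm. 1.2 with Cor. 1.5 (1)] -/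
theorem criticalCorr_eq_zero_of_odd (hd : 3 ≤ d) {n : ℕ} (hn : Odd n) (y : Fin n → Site d) :
    criticalCorr d n y = 0 := by
  classical
  obtain ⟨A, hA, hyA⟩ := exists_spinMonomial_eq_spinProduct_odd hn y
  have : criticalCorr d n y = plusCorr d (criticalBeta d) 0 A := by
    show plusExpect d (criticalBeta d) 0 (spinMonomial y) = _
    rw [hyA]
    rfl
  rw [this]
  exact plusCorr_eq_zero_of_odd_card (criticalBeta_nonneg d)
    (spontaneousMagnetization_criticalBeta_eq_zero_holds hd) hA

/-! ### The finite-volume connected four-point function converges to the critical one -/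

/-- The free-boundary box connected four-point function at `β_c` converges, as `Λ_L ↑ ℤ^d`, to
`U₄(y) = ⟨σ_{y₀}σ_{y₁}σ_{y₂}σ_{y₃}⟩_{β_c} - ∑_{pairings}⟨σσ⟩_{β_c}⟨σσ⟩_{β_c}` (`d ≥ 3`;
`criticalCorr_wellDefined_holds` on each piece). [cite: FriedliVelenik2017, Thm. 3.17 and Lemma 3.23] -/
theorem tendsto_connectedFour_box_criticalBeta (hd : 3 ≤ d) (y : Fin 4 → Site d) :
    Tendsto (fun L : ℕ => connectedFour (isingMeasure (zdGraph d) (box d L) (criticalBeta d) 0 .free)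
      spinAt y) atTop (𝓝 (criticalCorr d 4 y - (criticalCorr d 2 ![y 0, y 1] * criticalCorr d 2 ![y 2, y 3]
        + criticalCorr d 2 ![y 0, y 2] * criticalCorr d 2 ![y 1, y 3]
        + criticalCorr d 2 ![y 0, y 3] * criticalCorr d 2 ![y 1, y 2]))) := by
  classical
  have hmem : (BoundaryCondition.free : BoundaryCondition (Site d)) ∈
      ({.free, .plus, .minus} : Set (BoundaryCondition (Site d))) := by simp
  have h4 : Tendsto (fun L : ℕ => isingExpect (zdGraph d) (box d L) (criticalBeta d) 0 .free
      (spinMonomial y)) atTop (𝓝 (criticalCorr d 4 y)) :=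
    criticalCorr_wellDefined_holds (d := d) hd 4 y .free hmem
  have h2 : ∀ i j : Fin 4, Tendsto (fun L : ℕ => isingExpect (zdGraph d) (box d L) (criticalBeta d) 0
      .free (spinMonomial ![y i, y j])) atTop (𝓝 (criticalCorr d 2 ![y i, y j])) := fun i j =>
    criticalCorr_wellDefined_holds (d := d) hd 2 ![y i, y j] .free hmem
  have hlim := h4.sub ((((h2 0 1).mul (h2 2 3)).add ((h2 0 2).mul (h2 1 3))).add
    ((h2 0 3).mul (h2 1 2)))
  refine hlim.congr fun L => ?_
  have hpair : ∀ a b : Site d,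
      twoPoint (isingMeasure (zdGraph d) (box d L) (criticalBeta d) 0 .free) spinAt a b =
        isingExpect (zdGraph d) (box d L) (criticalBeta d) 0 .free (spinMonomial ![a, b]) := by
    intro a b
    simp only [twoPoint, isingExpect, spinMonomial, Fin.prod_univ_two, Matrix.cons_val_zero,
      Matrix.cons_val_one]
  have hfour : nPoint (isingMeasure (zdGraph d) (box d L) (criticalBeta d) 0 .free) spinAt y =
      isingExpect (zdGraph d) (box d L) (criticalBeta d) 0 .free (spinMonomial y) := rfl
  rw [connectedFour, hfour, hpair, hpair, hpair, hpair, hpair, hpair]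
  ring

/-- Eventually every point of a finite configuration lies in the box `Λ_L`. [folklore] -/
private theorem eventually_forall_mem_box_fin {n : ℕ} (y : Fin n → Site d) :
    ∀ᶠ L : ℕ in atTop, ∀ i, y i ∈ box d L := by
  classical
  obtain ⟨L₀, hL₀⟩ := exists_forall_subset_box d (Finset.univ.image y)
  filter_upwards [eventually_ge_atTop L₀] with L hL i
  exact hL₀ L hL (Finset.mem_image_of_mem y (Finset.mem_univ i))

/-! ### Lebowitz' inequality for the critical state -/

/-- **Lebowitz' inequality for the critical state on `ℤ^d`, `d ≥ 3`**: `U₄(y) ≤ 0` for every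
`y : Fin 4 → ℤ^d` (coincidences allowed). Box limit of the finite-volume free-boundary inequality
`lebowitz_holds`. [cite: Lebowitz1974, Theorem, eq. (2.5b)] [cite: GlimmJaffe1987, Cor. 4.3.3] -/
theorem criticalUrsellFour_nonpos (hd : 3 ≤ d) (y : Fin 4 → Site d) :
    criticalCorr d 4 y - (criticalCorr d 2 ![y 0, y 1] * criticalCorr d 2 ![y 2, y 3]
        + criticalCorr d 2 ![y 0, y 2] * criticalCorr d 2 ![y 1, y 3]
        + criticalCorr d 2 ![y 0, y 3] * criticalCorr d 2 ![y 1, y 2]) ≤ 0 := by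
  classical
  refine le_of_tendsto (tendsto_connectedFour_box_criticalBeta hd y) ?_
  filter_upwards [eventually_forall_mem_box_fin y] with L hL
  exact lebowitz_holds (zdGraph d) (criticalBeta_nonneg d) (box d L) y hL

/-! ### `|U₄| ≤ 2⟨σσ⟩⟨σσ⟩` -/

/-- The double-current measure has total mass `≤ 1` on every set: it is a probability measure when
currents with the prescribed sources exist (`isProbabilityMeasure_doubleCurrentMeasure_holds`) and
the zero measure otherwise. [cite: DuminilCopin2016, §2.2] -/
theorem doubleCurrentMeasure_real_le_one {V : Type*} [Fintype V] [DecidableEq V] (G : SimpleGraph V)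
    [DecidableRel G.Adj] {β : ℝ} (hβ : 0 ≤ β) (A B : Finset V) (s : Set (Current G × Current G)) :
    (doubleCurrentMeasure G β A B).real s ≤ 1 := by
  by_cases h : currentSum G β A ≠ 0 ∧ currentSum G β B ≠ 0
  · haveI := isProbabilityMeasure_doubleCurrentMeasure_holds G hβ h.1 h.2
    exact measureReal_le_one
  · have h0 : currentSum G β A * currentSum G β B = 0 := mul_eq_zero.2 (by tauto)
    have hμ : doubleCurrentMeasure G β A B = 0 := by
      simp [doubleCurrentMeasure, h0]
    simp [hμ]

/-- Hence the box trace law `P^{A,B}_{Λ_L,β}` (`sourcedDoubleCurrentLaw`) gives every measurable event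
probability `≤ 1`. [cite: AizenmanDuminilCopinAnnals2021, §3.1] -/
theorem sourcedDoubleCurrentLaw_real_le_one (L : ℕ) {β : ℝ} (hβ : 0 ≤ β) (A B : Finset (Site d))
    {S : Set (BondConfig (Site d))} (hS : MeasurableSet S) :
    (sourcedDoubleCurrentLaw d L β A B).real S ≤ 1 := by
  rw [measureReal_def, sourcedDoubleCurrentLaw_apply L β A B hS, ← measureReal_def]
  exact doubleCurrentMeasure_real_le_one _ hβ _ _ _

/-- **`|U₄| ≤ 2|⟨σσ⟩||⟨σσ⟩|` in a box** (free boundary, `β_c`, the four points in `Λ_L`): from the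
proved box identity `U₄ = -2⟨σ_{y₀}σ_{y₁}⟩⟨σ_{y₂}σ_{y₃}⟩·P^{y₀y₁,y₂y₃}_{Λ_L}[y₀ ↔ y₂]`
(`connectedFour_free_box_eq`) and `P ≤ 1`. [cite: AizenmanDuminilCopinAnnals2021, eq. (3.12)] -/
theorem abs_connectedFour_box_criticalBeta_le {L : ℕ} {y : Fin 4 → Site d} (hy : ∀ i, y i ∈ box d L) :
    |connectedFour (isingMeasure (zdGraph d) (box d L) (criticalBeta d) 0 .free) spinAt y| ≤
      2 * |isingTwoPoint (zdGraph d) (box d L) (criticalBeta d) 0 .free (y 0) (y 1)| *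
        |isingTwoPoint (zdGraph d) (box d L) (criticalBeta d) 0 .free (y 2) (y 3)| := by
  classical
  have hy4 : y = ![y 0, y 1, y 2, y 3] := by funext i; fin_cases i <;> rfl
  rw [hy4, connectedFour_free_box_eq (d := d) L (criticalBeta_nonneg d) (hy 0) (hy 1) (hy 2) (hy 3)]
  simp only [Matrix.cons_val_zero, Matrix.cons_val_one, Matrix.cons_val]
  have hP := sourcedDoubleCurrentLaw_real_le_one (d := d) L (criticalBeta_nonneg d)
    ({y 0} ∆ {y 1}) ({y 2} ∆ {y 3}) (measurableSet_openConn_holds (y 0) (y 2))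
  have hP0 : 0 ≤ (sourcedDoubleCurrentLaw d L (criticalBeta d) ({y 0} ∆ {y 1}) ({y 2} ∆ {y 3})).real
      (openConn (y 0) (y 2)) := measureReal_nonneg
  rw [abs_mul, abs_mul, abs_mul, abs_neg, abs_two, abs_of_nonneg hP0]
  have h2 : 0 ≤ 2 * |isingTwoPoint (zdGraph d) (box d L) (criticalBeta d) 0 .free (y 0) (y 1)| *
      |isingTwoPoint (zdGraph d) (box d L) (criticalBeta d) 0 .free (y 2) (y 3)| := by positivity
  calc 2 * |isingTwoPoint (zdGraph d) (box d L) (criticalBeta d) 0 .free (y 0) (y 1)| *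
        |isingTwoPoint (zdGraph d) (box d L) (criticalBeta d) 0 .free (y 2) (y 3)| *
        (sourcedDoubleCurrentLaw d L (criticalBeta d) ({y 0} ∆ {y 1}) ({y 2} ∆ {y 3})).real
          (openConn (y 0) (y 2))
      ≤ 2 * |isingTwoPoint (zdGraph d) (box d L) (criticalBeta d) 0 .free (y 0) (y 1)| *
        |isingTwoPoint (zdGraph d) (box d L) (criticalBeta d) 0 .free (y 2) (y 3)| * 1 :=
        mul_le_mul_of_nonneg_left hP h2
    _ = _ := mul_one _

/-- `0 ≤ ⟨σ_aσ_b⟩_{β_c}` as a `criticalCorr d 2` value (Griffiths I). [cite: FriedliVelenik2017, Theorem 3.20] -/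
theorem criticalCorr_two_nonneg (a b : Site d) : 0 ≤ criticalCorr d 2 ![a, b] := by
  rw [criticalCorr_two_pair]; exact criticalTwoPoint_nonneg' _

/-- **`|U₄(y)| ≤ 2⟨σ_{y₀}σ_{y₁}⟩_{β_c}⟨σ_{y₂}σ_{y₃}⟩_{β_c}` on `ℤ^d`, `d ≥ 3`** (all `y`,
coincidences allowed; by the symmetry of `U₄` the same holds for the other two pairings): the
infinite-volume, critical-state form of Aizenman–Duminil-Copin 2021 (3.12) with intersection
probability `≤ 1`, by the box limit of `abs_connectedFour_box_criticalBeta_le`. So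
`|U₄|/(2⟨σσ⟩⟨σσ⟩) ∈ [0,1]` is (the `L → ∞` limit of) the probability that the two double-current
clusters meet. [cite: AizenmanDuminilCopinAnnals2021, eq. (3.12)] -/
theorem abs_criticalUrsellFour_le_two_mul (hd : 3 ≤ d) (y : Fin 4 → Site d) :
    |criticalCorr d 4 y - (criticalCorr d 2 ![y 0, y 1] * criticalCorr d 2 ![y 2, y 3]
        + criticalCorr d 2 ![y 0, y 2] * criticalCorr d 2 ![y 1, y 3]
        + criticalCorr d 2 ![y 0, y 3] * criticalCorr d 2 ![y 1, y 2])| ≤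
      2 * criticalCorr d 2 ![y 0, y 1] * criticalCorr d 2 ![y 2, y 3] := by
  classical
  have hmem : (BoundaryCondition.free : BoundaryCondition (Site d)) ∈
      ({.free, .plus, .minus} : Set (BoundaryCondition (Site d))) := by simp
  have hT : ∀ i j : Fin 4, Tendsto (fun L : ℕ => isingTwoPoint (zdGraph d) (box d L) (criticalBeta d) 0
      .free (y i) (y j)) atTop (𝓝 (criticalCorr d 2 ![y i, y j])) := by
    intro i j
    have h := criticalCorr_wellDefined_holds (d := d) hd 2 ![y i, y j] .free hmem
    refine Tendsto.congr (fun L => ?_) h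
    simp only [isingTwoPoint, spinMonomial_two]
  have hR := ((hT 0 1).abs.const_mul 2).mul (hT 2 3).abs
  have hle := le_of_tendsto_of_tendsto (tendsto_connectedFour_box_criticalBeta hd y).abs hR
    ((eventually_forall_mem_box_fin y).mono fun L hL => abs_connectedFour_box_criticalBeta_le hL)
  rwa [abs_of_nonneg (criticalCorr_two_nonneg _ _), abs_of_nonneg (criticalCorr_two_nonneg _ _)] at hle

/-! ### The sign of `U₄` of a pointwise scaling limit -/

/-- The rescaled lattice `U₄` at `[x/δ]` converges to `U₄^S(x) = limitConnectedFour S x` for a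
pointwise scaling limit `S` of the critical correlators (Step 1 of
`limitConnectedFour_eq_zero_of_hasPointwiseScalingLimit_holds`, isolated for reuse). [cite: AizenmanCDM2020, §10.1 eqs. (10.1)–(10.2)] -/
theorem tendsto_rescaled_criticalUrsellFour {ρ : ℝ → ℝ} {S : CorrFamily d}
    (hlim : HasPointwiseScalingLimit (criticalCorr d) ρ S) {x : Fin 4 → EuclideanSpace ℝ (Fin d)}
    (hx : x ∈ NonCoincident d 4) :
    Tendsto (fun δ => ρ δ ^ 4 * (criticalCorr d 4 (fun i => latticeApprox δ (x i)) -
      (criticalCorr d 2 ![latticeApprox δ (x 0), latticeApprox δ (x 1)] *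
          criticalCorr d 2 ![latticeApprox δ (x 2), latticeApprox δ (x 3)]
        + criticalCorr d 2 ![latticeApprox δ (x 0), latticeApprox δ (x 2)] *
          criticalCorr d 2 ![latticeApprox δ (x 1), latticeApprox δ (x 3)]
        + criticalCorr d 2 ![latticeApprox δ (x 0), latticeApprox δ (x 3)] *
          criticalCorr d 2 ![latticeApprox δ (x 1), latticeApprox δ (x 2)]))) (𝓝[>] 0)
      (𝓝 (limitConnectedFour S x)) := by
  have hinj : Function.Injective x := hx
  have hpair : ∀ i j, i ≠ j → Tendsto
      (fun δ => ρ δ ^ 2 * criticalCorr d 2 ![latticeApprox δ (x i), latticeApprox δ (x j)])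
      (𝓝[>] 0) (𝓝 (S 2 ![x i, x j])) := by
    intro i j hij
    have hmem : (![x i, x j] : Fin 2 → EuclideanSpace ℝ (Fin d)) ∈ NonCoincident d 2 :=
      pair_mem_nonCoincident fun h => hij (hinj h)
    refine Tendsto.congr (fun δ => ?_) ((hlim 2).tendsto_at hmem)
    rw [rescaledCorrelator_apply, latticeApprox_comp_two]
    rfl
  have h4 : Tendsto (fun δ => ρ δ ^ 4 * criticalCorr d 4 (fun i => latticeApprox δ (x i)))
      (𝓝[>] 0) (𝓝 (S 4 x)) := (hlim 4).tendsto_at hx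
  have h := h4.sub ((((hpair 0 1 (by decide)).mul (hpair 2 3 (by decide))).add
    ((hpair 0 2 (by decide)).mul (hpair 1 3 (by decide)))).add
    ((hpair 0 3 (by decide)).mul (hpair 1 2 (by decide))))
  have hlim_eq : limitConnectedFour S x = S 4 x - (S 2 ![x 0, x 1] * S 2 ![x 2, x 3]
      + S 2 ![x 0, x 2] * S 2 ![x 1, x 3] + S 2 ![x 0, x 3] * S 2 ![x 1, x 2]) := rfl
  rw [hlim_eq]
  refine Tendsto.congr (fun δ => ?_) h
  ring

/-- **`U₄^S ≤ 0` for every pointwise scaling limit of the critical correlators** (`d ≥ 3`, ANY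
renormalisation `ρ` — its sign is irrelevant since `ρ⁴ ≥ 0` — and no non-degeneracy assumed): Lebowitz'
inequality passes to the limit. [cite: Lebowitz1974, Theorem, eq. (2.5b)] [cite: Aizenman1982, §1] -/
theorem limitConnectedFour_nonpos_of_hasPointwiseScalingLimit (hd : 3 ≤ d) {ρ : ℝ → ℝ}
    {S : CorrFamily d} (hlim : HasPointwiseScalingLimit (criticalCorr d) ρ S)
    {x : Fin 4 → EuclideanSpace ℝ (Fin d)} (hx : x ∈ NonCoincident d 4) :
    limitConnectedFour S x ≤ 0 := by
  refine le_of_tendsto (tendsto_rescaled_criticalUrsellFour hlim hx)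
    (Filter.Eventually.of_forall fun δ => ?_)
  have h4 : (0 : ℝ) ≤ ρ δ ^ 4 := by positivity
  exact mul_nonpos_of_nonneg_of_nonpos h4 (criticalUrsellFour_nonpos hd _)

/-- **Clause (iii) is one-sided**: for a pointwise scaling limit `S` of the critical correlators
(`d ≥ 3`), `HasNontrivialU4 S ↔ ∃ x ∈ NonCoincident d 4, limitConnectedFour S x < 0`. [cite: Aizenman1982, §1] -/
theorem hasNontrivialU4_iff_exists_neg_of_hasPointwiseScalingLimit (hd : 3 ≤ d) {ρ : ℝ → ℝ}
    {S : CorrFamily d} (hlim : HasPointwiseScalingLimit (criticalCorr d) ρ S) :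
    HasNontrivialU4 S ↔ ∃ x ∈ NonCoincident d 4, limitConnectedFour S x < 0 := by
  constructor
  · rintro ⟨x, hx, hne⟩
    exact ⟨x, hx, lt_of_le_of_ne (limitConnectedFour_nonpos_of_hasPointwiseScalingLimit hd hlim hx) hne⟩
  · rintro ⟨x, hx, hlt⟩
    exact ⟨x, hx, hlt.ne⟩

end Literature.Probability.LatticeModels

end
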